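import Mathlib
import Summits.ValiantsHypothesis.ValiantsHypothesis.Theorems.FifoMatchingNNLinearDegreeCofactorHardOuterWitness
import Summits.ValiantsHypothesis.ValiantsHypothesis.Theorems.FifoMatchingNNLinearDegreeCofactorHardAvoidingMatchings
import HarnessLib

/-!
# Route FifoMatching — crux `NNLinearDegreeCofactorHard` (stmt-ValiantsHypothesis-23918), line `internal_cofactor`:
# stub S2b — GOOD ENDS (SPEC S0) and the outer witness: choosing the carving

SPEC `Lines/internal_cofactor-S2b-SPEC.md`, item S0 (acting lead p4): the (ii) measure (every `R`-letter a POP)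
lives on a carved instance `I = [a₁, a₁ + 2m)` of `[2n]` whose defect set `R' = {j : a₁ + j ∈ R}` has density
`≤ 1/4` in EVERY PREFIX and EVERY SUFFIX of `I`:  `4·|R' ∩ [0,t)| ≤ t` and `4·|R' ∩ [2m−t, 2m)| ≤ t` for all
`t ≤ 2m` (no tameness inside: runs may sit anywhere else — adversary (γ) of the constraints memo is respected).
This file DISCHARGES S0 together with the outer-witness hypothesis of `…Excision.lean`:

* `exists_good_start` — for any weight `c` and lower bound `x₀` with `x₀ + c|R| + 2 ≤ N`: an EVEN
  `a₁ ∈ [x₀, x₀ + c|R| + 2]` with `c·|R ∩ [a₁, a₁+t)| ≤ t` for every window (last maximiser of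
  `c·|R ∩ [0,x)| − x` on `[x₀, x₀ + c|R| + 1]`, rounded up to even);
* `exists_good_end` — the mirror image (via `Fin.rev`), for even `N`;
* `card_trace_prefix`, `card_trace_suffix`, `card_trace_le` — counts of the trace `R'` read in `Fin (2m)`;
* `exists_good_carving` — **for `14·|R| + 10 ≤ 2n` there is a carving `C` with `2n ≤ 2·C.m + 12|R| + 4`,
  `3 ≤ C.m`, an OUTER WITNESS (`…OuterWitness.exists_outer_witness` fed with three instances of
  `AvoidingMatchings.exists_nestFree_avoiding`), and S0 for its trace `R'`.**

Honest framing: elementary counting / plumbing for one stub of an OPEN crux; nothing here bears on the crux,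
`NNDivisionHard`, `NNNotVP` or `VP ≠ VNP` (NOT proved).  No definitions, no named facts. [folklore]
-/

noncomputable section

-- Sub = Summit single-conjunct layout: the duplicated namespace component is mandated by the tree.
set_option linter.dupNamespace false

namespace Summit.ValiantsHypothesis.ValiantsHypothesis.Theorems.FifoMatching.NNLinearDegreeCofactorHard.InternalCofactor

open Finset Literature.Computability.AlgebraicComplexity
open Summit.ValiantsHypothesis.ValiantsHypothesis.Theorems.FifoMatching.NNLowDegreeCofactorHard.FreedVertices.Carve
open Summit.ValiantsHypothesis.ValiantsHypothesis.Theorems.FifoMatching.NNLinearDegreeCofactorHard.AvoidingMatchings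

/-! ### Windows and prefixes -/
/-- Window counts are differences of prefix counts. [folklore] -/
theorem card_filter_window_eq_sub {N : ℕ} (R : Finset (Fin N)) {a b : ℕ} (hab : a ≤ b) :
    ((R.filter fun i => a ≤ i.val ∧ i.val < b).card : ℤ) =
      ((R.filter fun i => i.val < b).card : ℤ) - ((R.filter fun i => i.val < a).card : ℤ) := by
  have hsplit : (R.filter fun i => i.val < b) =
      (R.filter fun i => i.val < a) ∪ (R.filter fun i => a ≤ i.val ∧ i.val < b) := by
    ext i
    simp only [mem_filter, mem_union]
    constructor
    · intro h
      by_cases hi : i.val < a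
      · exact Or.inl ⟨h.1, hi⟩
      · exact Or.inr ⟨h.1, not_lt.1 hi, h.2⟩
    · rintro (h | h)
      · exact ⟨h.1, lt_of_lt_of_le h.2 hab⟩
      · exact ⟨h.1, h.2.2⟩
  have hdisj : Disjoint (R.filter fun i => i.val < a) (R.filter fun i => a ≤ i.val ∧ i.val < b) := by
    rw [disjoint_left]
    intro i h1 h2
    exact absurd (mem_filter.1 h1).2 (not_lt.2 (mem_filter.1 h2).2.1)
  rw [hsplit, card_union_of_disjoint hdisj]
  push_cast
  ring

/-! ### A good start -/
/-- **A good start.**  For `R ⊆ [N]`, a weight `c` and `x₀` with `x₀ + c|R| + 2 ≤ N` there is an EVEN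
`a₁ ∈ [x₀, x₀ + c|R| + 2]` such that `c·|R ∩ [a₁, a₁+t)| ≤ t` for every window `[a₁, a₁ + t) ⊆ [N]`.
[folklore] -/
theorem exists_good_start (c : ℕ) {N : ℕ} (R : Finset (Fin N)) (x₀ : ℕ)
    (hx : x₀ + c * R.card + 2 ≤ N) :
    ∃ a₁ : ℕ, a₁ % 2 = 0 ∧ x₀ ≤ a₁ ∧ a₁ ≤ x₀ + c * R.card + 2 ∧
      ∀ t : ℕ, a₁ + t ≤ N → c * (R.filter fun i => a₁ ≤ i.val ∧ i.val < a₁ + t).card ≤ t := by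
  -- the prefix count and the potential `g`
  set P : ℕ → ℤ := fun x => ((R.filter fun i => i.val < x).card : ℤ) with hP
  set g : ℕ → ℤ := fun x => (c : ℤ) * P x - x with hg
  have hPmono : ∀ {x y : ℕ}, x ≤ y → P x ≤ P y := fun {x y} hxy => by
    simp only [hP]
    exact_mod_cast card_le_card (fun i hi => mem_filter.2
      ⟨(mem_filter.1 hi).1, lt_of_lt_of_le (mem_filter.1 hi).2 hxy⟩)
  have hP0 : ∀ x, 0 ≤ P x := fun x => by simp only [hP]; positivity
  have hPle : ∀ x, P x ≤ R.card := fun x => by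
    simp only [hP]; exact_mod_cast card_le_card (filter_subset _ _)
  have hc0 : (0 : ℤ) ≤ c := by positivity
  -- last maximiser of `g` on the candidate range, via the tie-broken potential `h`
  set S : Finset ℕ := Finset.Icc x₀ (x₀ + c * R.card + 1) with hS
  have hSne : S.Nonempty := ⟨x₀, by rw [hS, mem_Icc]; omega⟩
  set h : ℕ → ℤ := fun x => (2 * (N : ℤ) + 2) * g x + x with hh
  obtain ⟨a₀, ha₀S, hmax⟩ := exists_max_image S h hSne
  rw [hS, mem_Icc] at ha₀S
  -- (A) later points of the range
  have hA : ∀ x, a₀ < x → x ≤ x₀ + c * R.card + 1 → g x < g a₀ := by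
    intro x hax hxS
    have h1 := hmax x (by rw [hS, mem_Icc]; omega)
    simp only [hh] at h1
    by_contra hcon
    push Not at hcon
    have h2 : (2 * (N : ℤ) + 2) * g a₀ ≤ (2 * (N : ℤ) + 2) * g x :=
      mul_le_mul_of_nonneg_left hcon (by positivity)
    have h3 : (a₀ : ℤ) < x := by exact_mod_cast hax
    linarith
  -- `g a₀ ≥ g x₀ ≥ -x₀`
  have hga₀ : -(x₀ : ℤ) ≤ g a₀ := by
    have h1 := hmax x₀ (by rw [hS, mem_Icc]; omega)
    simp only [hh] at h1
    have h2 : -(x₀ : ℤ) ≤ g x₀ := by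
      simp only [hg]; nlinarith [hP0 x₀, hc0]
    by_contra hcon
    push Not at hcon
    have h3 : g a₀ + 1 ≤ g x₀ := by linarith
    have h4 : (a₀ : ℤ) ≤ x₀ + c * R.card + 1 := by exact_mod_cast ha₀S.2
    have h5 : ((c : ℤ) * R.card + 2) ≤ N := by exact_mod_cast (by omega : c * R.card + 2 ≤ N)
    nlinarith
  -- (B) points beyond the range
  have hB : ∀ x, x₀ + c * R.card + 1 < x → g x < g a₀ := by
    intro x hxl
    have h1 : g x ≤ (c : ℤ) * R.card - x := by
      simp only [hg]; nlinarith [hPle x, hc0]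
    have h2 : (x₀ : ℤ) + c * R.card + 1 < x := by exact_mod_cast hxl
    linarith
  -- hence every `x > a₀` has `c |R ∩ [a₀, x)| ≤ x - a₀ - 1`
  have hC : ∀ x, a₀ < x → (c : ℤ) * (P x - P a₀) ≤ (x : ℤ) - a₀ - 1 := by
    intro x hax
    have hlt : g x < g a₀ := by
      by_cases hxS : x ≤ x₀ + c * R.card + 1
      · exact hA x hax hxS
      · exact hB x (not_le.1 hxS)
    simp only [hg] at hlt
    linarith
  -- round up to even
  refine ⟨a₀ + a₀ % 2, by omega, by omega, by omega, fun t ht => ?_⟩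
  rcases Nat.eq_zero_or_pos t with rfl | htpos
  · have : (R.filter fun i => a₀ + a₀ % 2 ≤ i.val ∧ i.val < a₀ + a₀ % 2 + 0) = ∅ :=
      filter_eq_empty_iff.2 fun i _ h => by omega
    rw [this, card_empty, mul_zero]
  have hwin := card_filter_window_eq_sub R (show a₀ + a₀ % 2 ≤ a₀ + a₀ % 2 + t by omega)
  have hmono : P a₀ ≤ P (a₀ + a₀ % 2) := hPmono (by omega)
  have hC' := hC (a₀ + a₀ % 2 + t) (by omega)
  have : ((c : ℤ) * ((R.filter fun i => a₀ + a₀ % 2 ≤ i.val ∧ i.val < a₀ + a₀ % 2 + t).card : ℤ))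
      ≤ t := by
    rw [hwin]
    simp only [hP] at hC' hmono
    push_cast at hC' ⊢
    have h5 : (a₀ : ℤ) % 2 ≤ 1 := by omega
    nlinarith
  exact_mod_cast this

/-! ### A good end (mirror image) -/
/-- **A good end.**  For `R ⊆ [N]` (`N` even), a weight `c` and `x₀` with `x₀ + c|R| + 2 ≤ N` there is
an EVEN `b₁` with `N − x₀ − c|R| − 2 ≤ b₁ ≤ N − x₀` such that `c·|R ∩ [b₁ − t, b₁)| ≤ t` for all
`t ≤ b₁` (apply `exists_good_start` to the reversed set). [folklore] -/
theorem exists_good_end (c : ℕ) {N : ℕ} (hN : N % 2 = 0) (R : Finset (Fin N)) (x₀ : ℕ)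
    (hx : x₀ + c * R.card + 2 ≤ N) :
    ∃ b₁ : ℕ, b₁ % 2 = 0 ∧ b₁ + x₀ ≤ N ∧ N ≤ b₁ + x₀ + c * R.card + 2 ∧
      ∀ t : ℕ, t ≤ b₁ → c * (R.filter fun i => b₁ ≤ i.val + t ∧ i.val < b₁).card ≤ t := by
  set Rr : Finset (Fin N) := R.map ⟨Fin.rev, Fin.rev_injective⟩ with hRr
  have hcard : Rr.card = R.card := card_map _
  obtain ⟨a₁, ha₁e, ha₁l, ha₁u, hgood⟩ := exists_good_start c Rr x₀ (by rw [hcard]; exact hx)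
  rw [hcard] at ha₁u
  refine ⟨N - a₁, by omega, by omega, by omega, fun t ht => ?_⟩
  have hwin := hgood t (by omega)
  have heq : (R.filter fun i => N - a₁ ≤ i.val + t ∧ i.val < N - a₁).card =
      (Rr.filter fun i => a₁ ≤ i.val ∧ i.val < a₁ + t).card := by
    rw [hRr, filter_map, card_map]
    congr 1
    refine filter_congr fun i _ => ?_
    simp only [Function.comp, Function.Embedding.coeFn_mk, Fin.val_rev]
    have := i.isLt
    omega
  rw [heq]
  exact hwin

/-! ### Counting the trace `R' = {j : a + j ∈ R}` of `R` on a carved interval -/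
variable {n : ℕ}

/-- Prefix counts of the trace are window counts of `R`. [folklore] -/
theorem card_trace_prefix (C : Carving n) (R : Finset (Fin (2 * n))) {t : ℕ} (ht : t ≤ 2 * C.m) :
    ((univ.filter fun j : Fin (2 * C.m) => C.up j ∈ R).filter fun j => j.val < t).card =
      (R.filter fun i => C.a ≤ i.val ∧ i.val < C.a + t).card := by
  refine card_bij' (fun j _ => C.up j) (fun i _ => C.dn i) (fun j hj => ?_) (fun i hi => ?_)
    (fun j _ => C.dn_up j) (fun i hi => ?_)
  · simp only [mem_filter, mem_univ, true_and] at hj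
    rw [mem_filter, C.coe_up]
    exact ⟨hj.1, by omega, by omega⟩
  · rw [mem_filter] at hi
    have hiI : i ∈ C.I := by rw [C.mem_I]; omega
    simp only [mem_filter, mem_univ, true_and, C.up_dn hiI, C.coe_dn hiI]
    exact ⟨hi.1, by omega⟩
  · rw [mem_filter] at hi
    exact C.up_dn (by rw [C.mem_I]; omega)

/-- Suffix counts of the trace are window counts of `R`. [folklore] -/
theorem card_trace_suffix (C : Carving n) (R : Finset (Fin (2 * n))) {t : ℕ} (ht : t ≤ 2 * C.m) :
    ((univ.filter fun j : Fin (2 * C.m) => C.up j ∈ R).filter fun j => 2 * C.m ≤ j.val + t).card =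
      (R.filter fun i => C.a + 2 * C.m ≤ i.val + t ∧ i.val < C.a + 2 * C.m).card := by
  refine card_bij' (fun j _ => C.up j) (fun i _ => C.dn i) (fun j hj => ?_) (fun i hi => ?_)
    (fun j _ => C.dn_up j) (fun i hi => ?_)
  · simp only [mem_filter, mem_univ, true_and] at hj
    rw [mem_filter, C.coe_up]
    have := j.isLt
    exact ⟨hj.1, by omega, by omega⟩
  · rw [mem_filter] at hi
    have hiI : i ∈ C.I := by rw [C.mem_I]; omega
    simp only [mem_filter, mem_univ, true_and, C.up_dn hiI, C.coe_dn hiI]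
    exact ⟨hi.1, by omega⟩
  · rw [mem_filter] at hi
    exact C.up_dn (by rw [C.mem_I]; omega)

/-- A trace of `R` along an injection has at most `|R|` points. [folklore] -/
theorem card_trace_le {k : ℕ} (R : Finset (Fin (2 * n))) (f : Fin (2 * k) → Fin (2 * n))
    (hf : Function.Injective f) :
    (univ.filter fun j : Fin (2 * k) => f j ∈ R).card ≤ R.card := by
  refine card_le_card_of_injOn f (fun j hj => ?_) (fun j₁ _ j₂ _ h => hf h)
  exact (mem_filter.1 (mem_coe.1 hj)).2

/-! ### The good carving -/
/-- **Good ends + outer witness (SPEC S0 discharged).**  If `14·|R| + 10 ≤ 2n` there is a carving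
`C` of `[2n]` (`I = [C.a, C.a + 2·C.m)`, `C.a` even) with `2n ≤ 2·C.m + 12|R| + 4` and `3 ≤ C.m`, an outer
witness `M₀` (nest-free perfect matching of `[2n]` avoiding `R` and mapping the outside of `I` to itself —
the hypothesis of `aeval_excise_avoiding` / `complexity_excised_le_mul_internal`), and whose trace
`R' = {j : C.a + j ∈ R}` has density `≤ 1/4` in every prefix and every suffix of `Fin (2·C.m)`.  Proof:
`exists_good_start` / `exists_good_end` with `c = 4`, `x₀ = 2|R|` (so the two outer blocks, of even
lengths, satisfy the hypothesis of `exists_nestFree_avoiding`), then `exists_outer_witness`. [folklore] -/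
theorem exists_good_carving (R : Finset (Fin (2 * n))) (hR : 14 * R.card + 10 ≤ 2 * n) :
    ∃ C : Carving n, 2 * n ≤ 2 * C.m + 12 * R.card + 4 ∧ 3 ≤ C.m ∧
      (∃ M₀ ∈ nestFreeMatchings (2 * n), (∀ i ∈ R, M₀ i ∉ R) ∧ (∀ i, i ∉ C.I → M₀ i ∉ C.I)) ∧
      ∀ t ≤ 2 * C.m,
        4 * ((univ.filter fun j : Fin (2 * C.m) => C.up j ∈ R).filter fun j => j.val < t).card ≤ t ∧
        4 * ((univ.filter fun j : Fin (2 * C.m) => C.up j ∈ R).filter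
          fun j => 2 * C.m ≤ j.val + t).card ≤ t := by
  obtain ⟨a₁, ha₁e, ha₁l, ha₁u, hstart⟩ := exists_good_start 4 R (2 * R.card) (by omega)
  obtain ⟨b₁, hb₁e, hb₁l, hb₁u, hend⟩ :=
    exists_good_end 4 (Nat.mul_mod_right 2 n) R (2 * R.card) (by omega)
  -- the carving `[a₁, b₁)`
  have hlen : a₁ + 6 ≤ b₁ := by omega
  obtain ⟨m, hm⟩ : ∃ m, b₁ = a₁ + 2 * m := ⟨(b₁ - a₁) / 2, by omega⟩
  let C : Carving n := ⟨a₁, m, by omega, by omega, ha₁e⟩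
  refine ⟨C, by show 2 * n ≤ 2 * m + 12 * R.card + 4; omega, by show 3 ≤ m; omega, ?_, ?_⟩
  · -- outer witness from three avoiding matchings
    have hcast : 2 * (C.a / 2) ≤ 2 * n := by show 2 * (a₁ / 2) ≤ 2 * n; omega
    have hcast' : C.a + 2 * C.m + 2 * (n - C.a / 2 - C.m) = 2 * n := by
      show a₁ + 2 * m + 2 * (n - a₁ / 2 - m) = 2 * n; omega
    refine exists_outer_witness C R ?_ ?_ ?_
    · refine exists_nestFree_avoiding _ ((card_trace_le R _ fun j₁ j₂ h => ?_).trans ?_)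
      · exact Fin.ext (by simpa using congrArg Fin.val h)
      · show R.card ≤ a₁ / 2; omega
    · refine exists_nestFree_avoiding _ ((card_trace_le R _ C.up_injective).trans ?_)
      show R.card ≤ m; omega
    · refine exists_nestFree_avoiding _ ((card_trace_le R _ fun j₁ j₂ h => ?_).trans ?_)
      · have h' := congrArg Fin.val h
        simp only [Fin.val_cast, Fin.val_natAdd] at h'
        exact Fin.ext (by omega)
      · show R.card ≤ n - a₁ / 2 - m; omega
  · intro t ht
    have ht' : t ≤ 2 * m := ht
    constructor
    · rw [card_trace_prefix C R ht]
      exact hstart t (by show a₁ + t ≤ 2 * n; omega)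
    · rw [card_trace_suffix C R ht]
      have h1 := hend t (by omega)
      have heq : (R.filter fun i => C.a + 2 * C.m ≤ i.val + t ∧ i.val < C.a + 2 * C.m) =
          (R.filter fun i => b₁ ≤ i.val + t ∧ i.val < b₁) := by
        refine filter_congr fun i _ => ?_
        show a₁ + 2 * m ≤ i.val + t ∧ i.val < a₁ + 2 * m ↔ _
        rw [hm]
      rw [heq]
      exact h1

end Summit.ValiantsHypothesis.ValiantsHypothesis.Theorems.FifoMatching.NNLinearDegreeCofactorHard.InternalCofactor

end
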